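import Summits.QuantumFields.BalabanUV.Beta.RemainderExplicitCarrierColumn
import Summits.QuantumFields.BalabanUV.Beta.RemainderExplicitRoad
import Literature.MathematicalPhysics.QuantumFieldTheory.Balaban1983to89.Beta.EntrywiseVolumeLimit

/-!
# Beta / RemainderExplicitCarrier — BINDER-OWNERS row D4, ROAD P3 (co-owner #3, unit `b2b-balaban-beta-d4-p3`), skeleton leaves E1 + E2 + V2:
# THE EXPLICIT CARRIER `carrierBal` OF THE ROAD'S END (`RemainderExplicitRoad.ExplicitCarrier 4 Mc`) — CONSTRUCTED — WITH ITS TWO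
# HYPOTHESIS-SHAPED FIELDS PROVED: (E) `Decay B₃ δ₀` (ONE pair for every volume, every domain, every source; level-free constants) AND
# (V) `Limit` (the entrywise infinite-volume limit of the restricted test configurations)

HONEST FRAMING (page 1 of everything the β sub-cell writes): discharging `BetaPertH` makes Bałaban's UV stability
UNCONDITIONAL — a real constructive-QFT result; it is NOT the continuum limit and NOT the Clay problem.  HONEST DEPENDENCY
(verbatim): «continuum YM on T⁴ ⇐ BetaPertH ∧ nine spine estimates (0/9 proved); BetaPertH ⇐ (D1) ∧ (D4) ∧ CAP+tail;
G-an2-4 gates asym, D1 and NE2/3/4.»  NOT IN PRINT; OUR CONSTRUCTION.  `[folklore]` assembly of the road's landed leaves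
(`RemainderExplicitCarrierColumn.exists_norm_col_le`, `RemainderExplicitCarrierGeometry`, `RemainderExplicitTorusColumn`,
`GAN24.FineReadoutDecay.exists_wH_decay`) and pv04's method-of-images volume calculus (`Beta.IsImageSum.scalarVolumeRate`,
`Beta.ScalarVolumeRate.tendsto_siteOf`).  No cited fact, no wall binder, no `def … : Prop`; nothing about Bałaban's densities is asserted.
NOT summit progress.

ABSOLUTE RULE (cell charter, verbatim): "No internally-minted statement may enter as a cited fact. Every hypothesis is
either kernel-proved in this package or a verbatim quotation of a PUBLISHED theorem with page reference. The manuscript(s)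
under audit are NOT citable for their own disputed steps — they are the thing under adjudication; programme-internal
(2001/route/tribunal) claims are never citable."

## What the carrier is (skeleton §3 leaf E1; the READING is (R.e) of `RemainderExplicitRoad`, not asserted here)

At RG level `j` (block side `N = Lc^{j+1} = ξ⁻¹`), cube side `Mc`, exhausting unit tori with `Nn n · Mc` sites per direction, channel
`(μ, ν)`: `Wn n := Π_{X ∈ 𝐃_j} (W_X × W_X)`, `W_X` = complex fine-torus 1-forms with the (3.14)/(4.4)-type norm of
`RemainderExplicitCarrierSpaces` (stencil window = the fine sites over `X`); `tc n X x := Pi.single X (col_μ, col_ν)` — the PAIR of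
restricted, periodised, Bałaban-normalised `U = 1` minimiser columns `N^5·ℋ^per` for the sources `(μ, x)`, `(ν, x)` (the pair encodes the
off-diagonal channel in the END's single-family slot: `F(a ⊕ b) := ½(E(a+b) − E(a) − E(b))` reads `½(Π_{μν} + Π_{νμ})`); `V Y` = functions
on the fine lattice sites over the cubes of the lattice domain `Y`, `r n Y` = read the `μ`-column of the factor `tproj Y` at those sites
(mod the fine period), `t Y x` = the infinite-volume Bałaban-normalised column `hBal κ μ (z − N•x)` there.
-/

noncomputable section

open Finset Filter Topology
open scoped BigOperators
open Literature.Probability.LatticeModels (TorusSite)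
open Literature.MathematicalPhysics.QuantumFieldTheory.LatticeForm (quo)
open Literature.MathematicalPhysics.QuantumFieldTheory.Balaban1983to89
open Literature.MathematicalPhysics.QuantumFieldTheory.Balaban1983to89.Beta
open Literature.MathematicalPhysics.QuantumFieldTheory.Balaban1983to89.TreeLengthTorus (TPt TDom proj natLift proj_natLift)
open Literature.MathematicalPhysics.QuantumFieldTheory.Balaban1983to89.B13ScaleTransfer (Pt)
open B12Sec2to5 (l1 l1_nonneg Decay510)
open B12Decay510Torus (tcubeOf distCT distCT_nonneg nearT proj_cubeOf_of_proj_eq)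
open B12Decay510Lattice (cubeOf)
open AffineAveraging (Form1 unitVec)
open B4ContourShift (supNorm supNorm_nonneg abs_le_supNorm)
open BlochFibreUniqueness (quo_add_zsmul)
open KernelSpecInstance (wH)
open Beta.RemainderLimitTorus (LDom tproj tproj_val)
open Summit.QuantumFields.BalabanUV.Beta.GAN24.TorusPeriodise (pshift Hper)
open Summit.QuantumFields.BalabanUV.Beta.GAN24.FineReadoutDecay (exists_wH_decay)
open Summit.QuantumFields.BalabanUV.Beta.RemainderExplicitUnits (side side_pos hBal)
open Summit.QuantumFields.BalabanUV.Beta.RemainderExplicitTorusColumn (periodise_block_decay hasSum_Hper_wH)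
open Summit.QuantumFields.BalabanUV.Beta.RemainderExplicitTorusBounds (hTor)
open Summit.QuantumFields.BalabanUV.Beta.RemainderExplicitCarrierSpaces (RCfg val evalCLM evalCLM_apply ext)
open Summit.QuantumFields.BalabanUV.Beta.RemainderExplicitCarrierGeometry (usite collar usite_add_mem_collar hTor_add_pshift
  exists_natLift_proj_eq)
open Summit.QuantumFields.BalabanUV.Beta.RemainderExplicitCarrierColumn (fineOver mem_fineOver colVal col val_col ext_colVal_eq
  near1_self usite_natLift_proj exists_norm_col_le)
open Summit.QuantumFields.BalabanUV.Beta.RemainderExplicitRoad (ExplicitCarrier)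

namespace Summit.QuantumFields.BalabanUV.Beta.RemainderExplicitCarrier

variable (Lc : ℕ) [NeZero Lc] (j : ℕ) (Mc : ℕ) [NeZero Mc] (Nn : ℕ → ℕ) [∀ n, NeZero (Nn n)]

/-! ## §1 The test-vector spaces and the test configurations -/

/-- The (3.14)/(4.4)-type space of the domain `X` at volume index `n`. [folklore] -/
abbrev Wsp (n : ℕ) (X : TDom 4 (Nn n)) : Type :=
  RCfg (Lc ^ (j + 1) * (Nn n * Mc)) (side Lc j) (fineOver Lc j (Mc := Mc) X)

/-- **THE TEST-VECTOR SPACE** `Wn n := Π_X (W_X × W_X)` (finite product, sup norm). [folklore] -/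
abbrev Wn (n : ℕ) : Type := (X : TDom 4 (Nn n)) → Wsp Lc j Mc Nn n X × Wsp Lc j Mc Nn n X

/-- **THE TEST CONFIGURATION** for the source site `x` and the domain `X`: the pair of restricted columns for the channel `(μ, ν)`,
placed in the factor `X`. [folklore] -/
def tc (μ ν : Fin 4) (n : ℕ) (X : TDom 4 (Nn n)) (x : TPt 4 (Nn n * Mc)) : Wn Lc j Mc Nn n := by
  classical
  exact Pi.single X (col Lc j X μ x, col Lc j X ν x)

/-- [folklore] **(E) DECAY**: ONE pair `(δ₀, B₃)` — free of the level, the volume, the domain and the source — with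
`‖tc n X x‖ ≤ B₃·e^{−δ₀·distCT x (nearT x X)}`. -/
theorem exists_decay (μ ν : Fin 4) :
    ∃ δ₀ B₃ : ℝ, 0 < δ₀ ∧ 0 ≤ B₃ ∧ ∀ (n : ℕ) (X : TDom 4 (Nn n)) (x : TPt 4 (Nn n * Mc)),
      ‖tc Lc j Mc Nn μ ν n X x‖ ≤ B₃ * Real.exp (-δ₀ * distCT (Nn n) Mc x (nearT (M := Mc) x X)) := by
  obtain ⟨δ₀, B₃, hδ, hB, h⟩ := exists_norm_col_le (Lc := Lc)
  refine ⟨δ₀, B₃, hδ, hB, fun n X x => ?_⟩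
  classical
  unfold tc
  rw [Pi.norm_single, Prod.norm_def, max_le_iff]
  exact ⟨h j (Nn n) Mc X μ x, h j (Nn n) Mc X ν x⟩

/-! ## §2 The restriction data: fine lattice sites over a lattice domain, read modulo the fine period -/

/-- The index of a restricted configuration over the lattice domain `Y`: component, cube of `Y`, fine offset in the cube. [folklore] -/
abbrev Idx (Y : LDom 4) : Type := Fin 4 × (↥Y.1 × (Fin 4 → Fin (Mc * Lc ^ (j + 1))))

/-- The fine lattice point of (cube, offset): `z = (Mc·N)•c + f`. [folklore] -/
def zOf {Y : LDom 4} (cf : ↥Y.1 × (Fin 4 → Fin (Mc * Lc ^ (j + 1)))) : Fin 4 → ℤ :=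
  fun i => ((Mc * Lc ^ (j + 1) : ℕ) : ℤ) * (cf.1 : Pt 4) i + ((cf.2 i : ℕ) : ℤ)

/-- **THE RESTRICTED-CONFIGURATION SPACE** of the lattice domain `Y`: functions on its fine sites (finite product, sup norm). [folklore] -/
abbrev V (Y : LDom 4) : Type := Idx Lc j Mc Y → ℂ

/-- **THE RESTRICTION MAP**: read the `μ`-column of the factor `tproj (Nn n) Y` at the fine sites over `Y` (mod the fine period). [folklore] -/
def r (n : ℕ) (Y : LDom 4) : Wn Lc j Mc Nn n →L[ℂ] V Lc j Mc Y :=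
  ContinuousLinearMap.pi fun i : Idx Lc j Mc Y =>
    (evalCLM (side Lc j) (fineOver Lc j (Mc := Mc) (tproj (Nn n) Y)) (i.1, proj (Lc ^ (j + 1) * (Nn n * Mc)) (zOf Lc j Mc i.2))).comp
      ((ContinuousLinearMap.fst ℂ (Wsp Lc j Mc Nn n (tproj (Nn n) Y)) (Wsp Lc j Mc Nn n (tproj (Nn n) Y))).comp
        (ContinuousLinearMap.proj (R := ℂ) (φ := fun X : TDom 4 (Nn n) => Wsp Lc j Mc Nn n X × Wsp Lc j Mc Nn n X) (tproj (Nn n) Y)))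

/-- **THE INFINITE-VOLUME RESTRICTED TEST CONFIGURATION**: the Bałaban-normalised `ℤ⁴` column `hBal κ μ (z − N•x)` at the fine sites over `Y`. [folklore] -/
def t (μ : Fin 4) (Y : LDom 4) (x : Pt 4) : V Lc j Mc Y :=
  fun i => ((hBal Lc j i.1 μ (zOf Lc j Mc i.2 - ((Lc ^ (j + 1) : ℕ) : ℤ) • x) : ℝ) : ℂ)

/-- [folklore] `r` reads the first column of the factor `tproj Y` at the chosen sites. -/
theorem r_apply (n : ℕ) (Y : LDom 4) (w : Wn Lc j Mc Nn n) (i : Idx Lc j Mc Y) :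
    r Lc j Mc Nn n Y w i = val (w (tproj (Nn n) Y)).1 (i.1, proj (Lc ^ (j + 1) * (Nn n * Mc)) (zOf Lc j Mc i.2)) := rfl

/-! ## §3 The fine sites over `Y` project into the stencil window of `tproj Y` -/

/-- [folklore] The block of `zOf (c, f)` has cube `c`: `cubeOf Mc (quo_N (zOf (c,f))) = c`. -/
theorem cubeOf_quo_zOf {Y : LDom 4} (cf : ↥Y.1 × (Fin 4 → Fin (Mc * Lc ^ (j + 1)))) :
    cubeOf Mc (quo (Lc ^ (j + 1)) (zOf Lc j Mc cf)) = (cf.1 : Pt 4) := by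
  funext i
  have hN : (0 : ℤ) < (Lc ^ (j + 1) : ℕ) := by exact_mod_cast pow_pos (Nat.pos_of_ne_zero (NeZero.ne Lc)) _
  have hM : (0 : ℤ) < (Mc : ℕ) := by exact_mod_cast Nat.pos_of_ne_zero (NeZero.ne Mc)
  have hf0 : (0 : ℤ) ≤ ((cf.2 i : ℕ) : ℤ) := by positivity
  have hf1 : ((cf.2 i : ℕ) : ℤ) < (Mc : ℤ) * (Lc ^ (j + 1) : ℕ) := by
    have := (cf.2 i).isLt; push_cast; exact_mod_cast this
  show (zOf Lc j Mc cf i / ((Lc ^ (j + 1) : ℕ) : ℤ)) / (Mc : ℤ) = (cf.1 : Pt 4) i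
  have e1 : zOf Lc j Mc cf i = ((cf.2 i : ℕ) : ℤ) + ((Lc ^ (j + 1) : ℕ) : ℤ) * ((Mc : ℤ) * (cf.1 : Pt 4) i) := by
    simp only [zOf]; push_cast; ring
  rw [e1, Int.add_mul_ediv_left _ _ hN.ne', Int.add_mul_ediv_left _ _ hM.ne']
  have h2 : ((cf.2 i : ℕ) : ℤ) / ((Lc ^ (j + 1) : ℕ) : ℤ) / (Mc : ℤ) = 0 :=
    Int.ediv_eq_zero_of_lt (Int.ediv_nonneg hf0 hN.le) (Int.ediv_lt_of_lt_mul hN hf1)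
  rw [h2, zero_add]

/-- [folklore] **THE FINE SITES OVER `Y` LIE IN THE WINDOW OF `tproj Y`** on every torus of the family. -/
theorem proj_zOf_mem_fineOver (n : ℕ) {Y : LDom 4} (cf : ↥Y.1 × (Fin 4 → Fin (Mc * Lc ^ (j + 1)))) :
    proj (Lc ^ (j + 1) * (Nn n * Mc)) (zOf Lc j Mc cf) ∈ fineOver Lc j (Mc := Mc) (tproj (Nn n) Y) := by
  rw [mem_fineOver, usite_natLift_proj, tproj_val]
  unfold usite
  rw [← proj_cubeOf_of_proj_eq (N := Nn n) (M := Mc) (P := quo (Lc ^ (j + 1)) (zOf Lc j Mc cf)) rfl, cubeOf_quo_zOf]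
  exact Finset.mem_image_of_mem _ cf.1.2

/-! ## §4 (V) THE ENTRYWISE VOLUME LIMIT -/

/-- [folklore] `|v|₁ ≤ 4·(‖q + v‖∞ + ‖q‖∞)` on `ℤ⁴` (coordinatewise triangle inequality against the sup norm). -/
theorem l1_le_four_mul (q v : Fin 4 → ℤ) : l1 v ≤ 4 * (supNorm (q + v) + supNorm q) := by
  unfold l1
  have h : ∀ i : Fin 4, |((v i : ℤ) : ℝ)| ≤ supNorm (q + v) + supNorm q := by
    intro i
    have h1 := abs_le_supNorm (q + v) i
    have h2 := abs_le_supNorm q i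
    have e : ((v i : ℤ) : ℝ) = (((q + v) i : ℤ) : ℝ) - ((q i : ℤ) : ℝ) := by simp
    rw [e]
    calc |(((q + v) i : ℤ) : ℝ) - ((q i : ℤ) : ℝ)| ≤ |(((q + v) i : ℤ) : ℝ)| + |((q i : ℤ) : ℝ)| := abs_sub _ _
      _ ≤ supNorm (q + v) + supNorm q := by push_cast at h1 h2 ⊢; exact add_le_add (by exact_mod_cast h1) (by exact_mod_cast h2)
  calc ∑ i, |((v i : ℤ) : ℝ)| ≤ ∑ _i : Fin 4, (supNorm (q + v) + supNorm q) := Finset.sum_le_sum fun i _ => h i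
    _ = 4 * (supNorm (q + v) + supNorm q) := by simp; ring

/-- [folklore] **THE PERIOD SUM OF THE MINIMISER COLUMN TENDS TO ITS `t = 0` TERM AS THE VOLUME GROWS**:
`Σ_t wH κ μ (z′ + N•pshift (P_n) t) → wH κ μ z′` when `P_n = Nn n·Mc → ∞` (method of images, `IsImageSum.scalarVolumeRate`). -/
theorem tendsto_periodSum (hN : Tendsto Nn atTop atTop) (κ μ : Fin 4) (z' : Fin 4 → ℤ) :
    Tendsto (fun n => ∑' t : Fin 4 → ℤ, wH (N := Lc ^ (j + 1)) κ μ (z' + ((Lc ^ (j + 1) : ℕ) : ℤ) • pshift (fun _ : Fin 4 => Nn n * Mc) t))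
      atTop (𝓝 (wH (N := Lc ^ (j + 1)) κ μ z')) := by
  haveI : NeZero (Lc ^ (j + 1)) := ⟨pow_ne_zero _ (NeZero.ne Lc)⟩
  haveI hP : ∀ n, NeZero (Nn n * Mc) := fun n => ⟨mul_ne_zero (NeZero.ne (Nn n)) (NeZero.ne Mc)⟩
  obtain ⟨κ₀, C, hκ₀, hC, hb⟩ := exists_wH_decay (Lc := Lc)
  -- the ℤ⁴ function in the block variable and its images
  set Finf : (Fin 4 → ℤ) → ℝ := fun v => wH (N := Lc ^ (j + 1)) κ μ (z' + ((Lc ^ (j + 1) : ℕ) : ℤ) • v) with hFinf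
  set F : (n : ℕ) → Beta.Site 4 (Nn n * Mc) → ℝ :=
    fun n u => ∑' m : Fin 4 → ℤ, Finf (imageShift (Nn n * Mc) (windowMap 4 (Nn n * Mc) u) m) with hF
  -- block-scale bound of the summand family through `w ↦ wH (z' + N•w)`-translates
  have hg : ∀ w : Fin 4 → ℤ, |wH (N := Lc ^ (j + 1)) κ μ w|
      ≤ C * (((Lc ^ (j + 1) : ℕ) : ℝ) ^ 5)⁻¹ * Real.exp (-(κ₀ * supNorm (quo (Lc ^ (j + 1)) w))) := fun w => hb j κ μ w
  have himg : IsImageSum (fun n => Nn n * Mc) F Finf := by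
    intro n u
    have hs := (periodise_block_decay (N := Lc ^ (j + 1)) (fun w => wH (N := Lc ^ (j + 1)) κ μ w) hκ₀ hg
      (P := fun _ : Fin 4 => Nn n * Mc) (fun _ => Nat.one_le_iff_ne_zero.2 (NeZero.ne _))
      (z' + ((Lc ^ (j + 1) : ℕ) : ℤ) • windowMap 4 (Nn n * Mc) u)).1
    have e : (fun m : Fin 4 → ℤ => Finf (imageShift (Nn n * Mc) (windowMap 4 (Nn n * Mc) u) m))
        = fun t => wH (N := Lc ^ (j + 1)) κ μ (z' + ((Lc ^ (j + 1) : ℕ) : ℤ) • windowMap 4 (Nn n * Mc) u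
            + ((Lc ^ (j + 1) : ℕ) : ℤ) • pshift (fun _ : Fin 4 => Nn n * Mc) t) := by
      funext m; simp only [hFinf]; congr 1; funext i
      simp only [imageShift, pshift, Pi.add_apply, Pi.smul_apply, smul_eq_mul]; push_cast; ring
    rw [hF]; dsimp only; rw [e]
    exact hs.hasSum
  -- (5.10)-decay of `Finf` in the block variable
  have hdec : Decay510 Finf (C * (((Lc ^ (j + 1) : ℕ) : ℝ) ^ 5)⁻¹ * Real.exp (κ₀ * supNorm (quo (Lc ^ (j + 1)) z'))) (κ₀ / 4) := by
    intro v
    have h1 := hg (z' + ((Lc ^ (j + 1) : ℕ) : ℤ) • v)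
    rw [quo_add_zsmul] at h1
    refine h1.trans ?_
    rw [mul_assoc (C * _), ← Real.exp_add]
    refine mul_le_mul_of_nonneg_left (Real.exp_le_exp.2 ?_) (by positivity)
    have := l1_le_four_mul (quo (Lc ^ (j + 1)) z') v
    nlinarith [supNorm_nonneg (quo (Lc ^ (j + 1)) z' + v)]
  have hside : Tendsto (fun n => Nn n * Mc) atTop atTop :=
    tendsto_atTop_mono (fun n => Nat.le_mul_of_pos_right (Nn n) (Nat.pos_of_neZero Mc)) hN
  have hrate := ScalarVolumeRate.tendsto_siteOf (IsImageSum.scalarVolumeRate himg hdec (by positivity)) (by positivity)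
    (tendsto_imageTail_side (by positivity : (0 : ℝ) < κ₀ / 4) hside 4 _) hside 0
  -- read `F n [0]` as the period sum and `Finf 0` as the `t = 0` term
  have e0 : Finf 0 = wH (N := Lc ^ (j + 1)) κ μ z' := by simp [hFinf]
  have eF : ∀ n, F n (siteOf 4 (Nn n * Mc) 0)
      = ∑' t : Fin 4 → ℤ, wH (N := Lc ^ (j + 1)) κ μ (z' + ((Lc ^ (j + 1) : ℕ) : ℤ) • pshift (fun _ : Fin 4 => Nn n * Mc) t) := by
    intro n
    have hw : windowMap 4 (Nn n * Mc) (siteOf 4 (Nn n * Mc) 0) = 0 :=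
      windowMap_siteOf 4 (Nn n * Mc) fun i => inWindow_of_two_mul_abs_lt (by simp [Nat.pos_of_neZero])
    simp only [hF, hw]
    refine tsum_congr fun t => ?_
    simp only [hFinf]; congr 1; funext i
    simp only [imageShift, pshift, Pi.add_apply, Pi.smul_apply, smul_eq_mul, Pi.zero_apply]; push_cast; ring
  rw [← e0]
  refine hrate.congr fun n => ?_
  exact eF n

/-- [folklore] The test configuration placed in the factor `X`, read back at `X`. -/
theorem tc_apply_same (μ ν : Fin 4) (n : ℕ) (X : TDom 4 (Nn n)) (x : TPt 4 (Nn n * Mc)) :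
    tc Lc j Mc Nn μ ν n X x X = (col Lc j X μ x, col Lc j X ν x) := by
  classical
  unfold tc
  rw [Pi.single_eq_same]

/-- [folklore] Step A: the restricted value is the truncated column read at the class of the lattice point. -/
theorem r_tc_eq_colVal (μ ν : Fin 4) (Y : LDom 4) (x : Pt 4) (i : Idx Lc j Mc Y) (n : ℕ) :
    r Lc j Mc Nn n Y (tc Lc j Mc Nn μ ν n (tproj (Nn n) Y) (proj (Nn n * Mc) x)) i
      = colVal Lc j (tproj (Nn n) Y) μ (proj (Nn n * Mc) x) (i.1, proj (Lc ^ (j + 1) * (Nn n * Mc)) (zOf Lc j Mc i.2)) := by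
  rw [r_apply, tc_apply_same]
  rfl

/-- [folklore] Step B: over `Y` the truncation is invisible and the class is read through the fine periodicity —
`colVal (tproj Y) μ [x] (κ, [z]) = hTor μ x κ z` for the fine sites `z` over `Y`. -/
theorem colVal_proj_zOf (μ : Fin 4) (Y : LDom 4) (x : Pt 4) (κ : Fin 4) (cf : ↥Y.1 × (Fin 4 → Fin (Mc * Lc ^ (j + 1)))) (n : ℕ) :
    colVal Lc j (tproj (Nn n) Y) μ (proj (Nn n * Mc) x) (κ, proj (Lc ^ (j + 1) * (Nn n * Mc)) (zOf Lc j Mc cf))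
      = ((hTor Lc j (fun _ : Fin 4 => Nn n * Mc) μ x κ (zOf Lc j Mc cf) : ℝ) : ℂ) := by
  haveI : NeZero (Nn n * Mc) := ⟨mul_ne_zero (NeZero.ne (Nn n)) (NeZero.ne Mc)⟩
  -- read at the canonical lift of the class, where the truncation lemma applies
  have hB : colVal Lc j (tproj (Nn n) Y) μ (proj (Nn n * Mc) x) (κ, proj (Lc ^ (j + 1) * (Nn n * Mc)) (zOf Lc j Mc cf))
      = RemainderExplicitCarrierSpaces.ext (colVal Lc j (tproj (Nn n) Y) μ (proj (Nn n * Mc) x)) κ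
          (natLift (proj (Lc ^ (j + 1) * (Nn n * Mc)) (zOf Lc j Mc cf))) := by
    show _ = colVal Lc j (tproj (Nn n) Y) μ (proj (Nn n * Mc) x)
          (κ, proj (Lc ^ (j + 1) * (Nn n * Mc)) (natLift (proj (Lc ^ (j + 1) * (Nn n * Mc)) (zOf Lc j Mc cf))))
    rw [proj_natLift]
  rw [hB, ext_colVal_eq Lc j (proj_zOf_mem_fineOver Lc j Mc Nn n cf) μ _ κ (near1_self _),
    RemainderExplicitCarrierGeometry.hTor_natLift_proj]
  -- the source lift: natLift (proj x) = x + P•k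
  obtain ⟨k, hk⟩ := exists_natLift_proj_eq (Nn n * Mc) x
  have hp : (fun ν => ((Nn n * Mc : ℕ) : ℤ) * k ν) = pshift (fun _ : Fin 4 => Nn n * Mc) k := rfl
  rw [hk, hp, hTor_add_pshift j (fun _ : Fin 4 => Nn n * Mc) μ x k]

/-- [folklore] Step C: the Bałaban-normalised periodised column as `N^5` times the period sum of `wH`. -/
theorem hTor_eq_tsum (P : ℕ) [NeZero P] (μ : Fin 4) (x : Pt 4) (κ : Fin 4) (z : Fin 4 → ℤ) :
    hTor Lc j (fun _ : Fin 4 => P) μ x κ z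
      = side Lc j ^ 5 * ∑' t : Fin 4 → ℤ, wH (N := Lc ^ (j + 1)) κ μ
          (z - ((Lc ^ (j + 1) : ℕ) : ℤ) • x + ((Lc ^ (j + 1) : ℕ) : ℤ) • pshift (fun _ : Fin 4 => P) t) := by
  haveI : NeZero (Lc ^ (j + 1)) := ⟨pow_ne_zero _ (NeZero.ne Lc)⟩
  show side Lc j ^ 5 * Hper (Lc ^ (j + 1)) (fun _ : Fin 4 => P) μ x κ z = _
  rw [(hasSum_Hper_wH (N := Lc ^ (j + 1)) (fun _ : Fin 4 => P) μ x κ z).tsum_eq]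

/-- [folklore] **THE n-TH RESTRICTED VALUE IS THE BAŁABAN-NORMALISED PERIOD SUM** at the lattice point. -/
theorem r_tc_apply (μ ν : Fin 4) (Y : LDom 4) (x : Pt 4) (i : Idx Lc j Mc Y) (n : ℕ) :
    r Lc j Mc Nn n Y (tc Lc j Mc Nn μ ν n (tproj (Nn n) Y) (proj (Nn n * Mc) x)) i
      = ((side Lc j ^ 5 * ∑' t : Fin 4 → ℤ, wH (N := Lc ^ (j + 1)) i.1 μ
          (zOf Lc j Mc i.2 - ((Lc ^ (j + 1) : ℕ) : ℤ) • x + ((Lc ^ (j + 1) : ℕ) : ℤ) • pshift (fun _ : Fin 4 => Nn n * Mc) t) : ℝ) : ℂ) := by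
  haveI : NeZero (Nn n * Mc) := ⟨mul_ne_zero (NeZero.ne (Nn n)) (NeZero.ne Mc)⟩
  rw [r_tc_eq_colVal, colVal_proj_zOf, hTor_eq_tsum]

/-- [folklore] **(V) THE ENTRYWISE VOLUME LIMIT OF THE RESTRICTED TEST CONFIGURATIONS**. -/
theorem limit (hN : Tendsto Nn atTop atTop) (μ ν : Fin 4) (Y : LDom 4) (x : Pt 4) :
    Tendsto (fun n => r Lc j Mc Nn n Y (tc Lc j Mc Nn μ ν n (tproj (Nn n) Y) (proj (Nn n * Mc) x))) atTop
      (𝓝 (t Lc j Mc μ Y x)) := by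
  haveI : NeZero (Lc ^ (j + 1)) := ⟨pow_ne_zero _ (NeZero.ne Lc)⟩
  refine tendsto_pi_nhds.2 fun i => ?_
  simp only [r_tc_apply, t]
  have hlim := (tendsto_periodSum Lc j Mc Nn hN i.1 μ (zOf Lc j Mc i.2 - ((Lc ^ (j + 1) : ℕ) : ℤ) • x)).const_mul (side Lc j ^ 5)
  exact (Complex.continuous_ofReal.tendsto _).comp hlim

/-! ## §5 THE EXPLICIT CARRIER and its two proved fields -/

/-- **THE EXPLICIT CARRIER OF ROAD P3 AT LEVEL `j`** (`RemainderExplicitRoad.ExplicitCarrier 4 Mc`): CONSTRUCTED from the typed `U = 1`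
minimiser — no field is a hypothesis. [folklore] -/
def carrierBal (hN : Tendsto Nn atTop atTop) (μ ν : Fin 4) : ExplicitCarrier 4 Mc where
  N := Nn
  hNlim := hN
  Wn := Wn Lc j Mc Nn
  tc := tc Lc j Mc Nn μ ν
  V := V Lc j Mc
  r := r Lc j Mc Nn
  t := t Lc j Mc μ

/-- [folklore] **(E) FOR THE EXPLICIT CARRIER**: `∃ δ₀ B₃, 0 < δ₀ ∧ 0 ≤ B₃ ∧ (carrierBal …).Decay B₃ δ₀` — and the SAME pair serves every level `j`. -/
theorem exists_decay_carrierBal (μ ν : Fin 4) :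
    ∃ δ₀ B₃ : ℝ, 0 < δ₀ ∧ 0 ≤ B₃ ∧ ∀ (j : ℕ) (Nn : ℕ → ℕ) [∀ n, NeZero (Nn n)] (hN : Tendsto Nn atTop atTop),
      (carrierBal Lc j Mc Nn hN μ ν).Decay B₃ δ₀ := by
  obtain ⟨δ₀, B₃, hδ, hB, h⟩ := exists_norm_col_le (Lc := Lc)
  refine ⟨δ₀, B₃, hδ, hB, fun j Nn _ hN n X x => ?_⟩
  classical
  show ‖tc Lc j Mc Nn μ ν n X x‖ ≤ B₃ * Real.exp (-δ₀ * distCT (Nn n) Mc x (nearT (M := Mc) x X))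
  unfold tc
  rw [Pi.norm_single, Prod.norm_def, max_le_iff]
  exact ⟨h j (Nn n) Mc X μ x, h j (Nn n) Mc X ν x⟩

/-- [folklore] **(V) FOR THE EXPLICIT CARRIER**: `(carrierBal …).Limit`. -/
theorem limit_carrierBal (hN : Tendsto Nn atTop atTop) (μ ν : Fin 4) : (carrierBal Lc j Mc Nn hN μ ν).Limit :=
  fun Y x => limit Lc j Mc Nn hN μ ν Y x

end Summit.QuantumFields.BalabanUV.Beta.RemainderExplicitCarrier

end
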